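import Literature.NumberTheory.Sieve.AsymptoticSieveForPrimesRoughBilinear
import HarnessLib

/-!
# Asymptotic sieve for primes under a (B*) with the printed saving `(log x)^{-2^{22}}`: the reduced sieved bilinear bound

Topic `Literature/NumberTheory/Sieve` (trunk T-SIEVE), a sequel of
`Literature.NumberTheory.Sieve.AsymptoticSieveForPrimesRoughBilinear`. Source: J. Friedlander,
H. Iwaniec, *Asymptotic sieve for primes*, Ann. of Math. 148 (1998) 1041–1065
[FriedlanderIwaniecASP1998] (= arXiv:math/9811186), §1 (B), §2 pp. 1046–1048 ((B) ⟹ (B′)),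
§9 Theorem 2 and §10 (B*), Theorem 3, p. 1065.

## Why this file exists

The tree proves FI's Theorem 1 with the sieved bilinear hypothesis (B*)
(`fi_asymptotic_sieve_primes_rough_loglog_holds`, `…Theorem3`) for squarefree-supported sequences,
demanding (B*) in the form `B*(x; N, C, P) ≤ A(x)(log x)^{-2^{26}}` with the explicit constant `1`
(`SieveSequence.FIAsymptoticSieveHypothesesRough`). FI's Theorem 2 (§9: sequences supported on all
integers, i.e. [FriedlanderIwaniecAnnals1998] Proposition 2.1) is proved by applying Theorem 1 to
`ã_n = μ²(n) a_n`, whose counting function is `Ã(x) = G A(x)(1 + O((log x)⁻¹))` with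
`G = ∏_p (1 - g(p²)) < 1` in general ((9.12)); the bilinear bound inherited from `a` is
`≤ A(x)(log x)^{-2^{26}} ≈ G⁻¹ Ã(x)(log x)^{-2^{26}}`, so the constant-`1` interface cannot be fed
(FI, p. 1062: "actually we saved at least a factor `log x` which is needed for clearing the implied
constants"). The proof of Theorem 1 consumes (B*) only through the reduced weighted bound
`∑_m 6^{ω(m)} |∑*_n γ μ a| ≤ K A(x)(log x)^{-k}` (`reduced_rough_bilinear_bound_six`), whose first step
weakens `(log x)^{-2^{26}}` to `(log x)^{-2^{22}}`. This file re-proves that reduced bound from the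
WEAKER clause
(B*₂₂) `B*(x; N, C, P) ≤ A(x)(log x)^{-2^{22}}` (the saving printed in (B) of Theorem 1, `fiLogSaving`),
with the hypotheses passed as separate arguments (the literal hypotheses of Theorem 1 with void
bilinear parameters, `FIAsymptoticSieveHypothesesCore.withTrivialBilinear`, plus the clause (B*₂₂)),
so that the sequels `…S2RoughWeak`, `…S3RoughWeak`, `…RoughWeakAssembly` can run the tree's proof of
Theorem 1 under (B*₂₂); the general Theorem 2/3 (`…Theorem2`) then feeds it with `ã`.

* `SieveSequence.FIAsymptoticSieveHypotheses.reduced_rough_bilinear_bound_six_of_le` — for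
  `k ≤ 2^{18}`: `∑_m 6^{ω(m)} |∑_{N<n≤2N, mn≤x, (n,Π)=1} γ(n;C) μ(mn) a_{mn}| ≤ K A(x)(log x)^{-k}` for
  large `x`, `N` in (B1), `C` in (B3), from (1.6), (1.16) and (B*₂₂). Proof verbatim that of
  `reduced_rough_bilinear_bound_six` (Hölder `(4, 4/3)`, `6^{4/3} ≤ 11`, the fourth moment
  `∑ a_k τ(k)⁴ ≪ A(x)(log x)^{2^{20}}`, `holder_tail_le_pow`).

## References

* J. Friedlander, H. Iwaniec, *Asymptotic sieve for primes*, Ann. of Math. 148 (1998), 1041–1065,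
  §2 (B′) pp. 1046–1048, §9 p. 1062, §10 p. 1065. [cite: FriedlanderIwaniecASP1998, §2 (B′) and §10 p. 1065]

## Mathlib / tree search

Tree: `reduced_rough_bilinear_bound_six`, `sum_six_pow_mul_le_holder`,
`sum_divisorsAntidiagonal_eleven_pow_mul_card_divisors_le` (`…RoughBilinear`), `holder_tail_le_pow`
(`…BilinearStrong`), `sum_sum_le_sum_divisorsAntidiagonal`,
`FIAsymptoticSieveHypotheses.sum_a_mul_card_divisors_pow_four_le` (`…Reduction`), `fiBilinearRough`,
`fiLogSaving`. `lean search 'bound_six_of_le|RoughWeak'`: nothing before this file.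
-/

noncomputable section

open Filter Finset
open scoped ArithmeticFunction.Moebius ArithmeticFunction.sigma ArithmeticFunction.omega

namespace Literature.NumberTheory.Sieve

variable {A : SieveSequence} {D δ Δ P : ℝ → ℝ}

/-- **Reduced sieved bilinear bound from (B*) with saving `(log x)^{-2^{22}}`** (FI §10 p. 1065 with
§2 (B) ⟹ (B′)): if `A` satisfies the literal hypotheses of Theorem 1 with void bilinear parameters
(`δ = 2√x`, `Δ = 2`; content: `size_eq`, (1.4), (1.6), (1.8), (1.9), (1.16), (R1), (R)) and the
sieved bilinear bound `B*(x; N, C, P(x)) ≤ A(x)(log x)^{-2^{22}}` for all large `x`, all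
`Δ⁻¹√D < N < δ⁻¹√x` and `1 ≤ C ≤ x/D`, then for every `k ≤ 2^{18}` there is `K` with
`∑_{m≤x} 6^{ω(m)} |∑_{N<n≤2N, mn≤x, (n,Π)=1} γ(n;C) μ(mn) a_{mn}| ≤ K A(x)(log x)^{-k}` in the same
ranges. [cite: FriedlanderIwaniecASP1998, §10 p. 1065 and §2 (B′)] -/
theorem SieveSequence.FIAsymptoticSieveHypotheses.reduced_rough_bilinear_bound_six_of_le
    (hT : A.FIAsymptoticSieveHypotheses D (fun x => 2 * Real.sqrt x) (fun _ => 2))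
    (hB : ∀ᶠ x : ℝ in atTop, ∀ N : ℝ, Real.sqrt (D x) / Δ x < N → N < Real.sqrt x / δ x →
      ∀ C : ℝ, 1 ≤ C → C ≤ x / D x →
        A.fiBilinearRough x N C (P x) ≤ A.size x / Real.log x ^ SieveSequence.fiLogSaving)
    {k : ℕ} (hk : k ≤ 2 ^ 18) :
    ∃ K : ℝ, ∀ᶠ x : ℝ in atTop, ∀ N : ℝ, Real.sqrt (D x) / Δ x < N → N < Real.sqrt x / δ x →
      ∀ C : ℝ, 1 ≤ C → C ≤ x / D x →
        ∑ m ∈ Icc 1 ⌊x⌋₊, (6 : ℝ) ^ m.primeFactors.card *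
          |∑ n ∈ (Ioc ⌊N⌋₊ ⌊2 * N⌋₊).filter
              (fun n : ℕ => ((m * n : ℕ) : ℝ) ≤ x ∧ ∀ p ∈ n.primeFactors, P x ≤ (p : ℝ)),
            (SieveSequence.fiGamma C n : ℝ) * (μ (m * n) : ℝ) * A.a (m * n)| ≤
          K * A.size x / Real.log x ^ k := by
  obtain ⟨K₆, h16⟩ := hT.2.2.1
  set C₁ : ℝ := 2 ^ 12 * max K₆ 0 * Real.exp (2 ^ 22) with hC₁
  have hC₁0 : 0 ≤ C₁ := by positivity
  refine ⟨C₁ + 1, ?_⟩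
  filter_upwards [h16, hB, eventually_ge_atTop (8 : ℝ)] with x h16x hBx hx8 N hN1 hN2 C hC1 hC2
  classical
  -- basics at `x`
  have hx1 : (1 : ℝ) < x := by linarith
  set L : ℝ := Real.log x with hLdef
  have hL1 : 1 ≤ L := by
    rw [hLdef, ← Real.log_exp 1]
    refine Real.log_le_log (Real.exp_pos 1) ?_
    have := Real.exp_one_lt_d9
    linarith
  have hL0 : 0 < L := by linarith
  have hA0 : 0 ≤ A.size x := by rw [hT.size_eq]; exact A.congrSum_nonneg 1 x
  set M := Icc 1 ⌊x⌋₊ with hMdef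
  set F : ℕ → Finset ℕ := fun m => (Ioc ⌊N⌋₊ ⌊2 * N⌋₊).filter
    (fun n : ℕ => ((m * n : ℕ) : ℝ) ≤ x ∧ ∀ p ∈ n.primeFactors, P x ≤ (p : ℝ)) with hFdef
  set I : ℕ → ℝ := fun m =>
    ∑ n ∈ F m, (SieveSequence.fiGamma C n : ℝ) * (μ (m * n) : ℝ) * A.a (m * n) with hIdef
  -- (B*₂₂): `R₀ ≤ A (log x)^{-2^22}`
  have hB0 : ∑ m ∈ M, |I m| ≤ A.size x * L ^ (-(2 ^ 22 : ℝ)) := by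
    have h0 := hBx N hN1 hN2 C hC1 hC2
    rw [SieveSequence.fiBilinearRough, SieveSequence.fiLogSaving] at h0
    refine h0.trans (le_of_eq ?_)
    rw [Real.rpow_neg hL0.le, ← div_eq_mul_inv]
    congr 1
    calc L ^ (2 ^ 22 : ℕ) = L ^ ((2 ^ 22 : ℕ) : ℝ) := (Real.rpow_natCast L (2 ^ 22)).symm
      _ = L ^ (2 ^ 22 : ℝ) := by norm_num
  -- `R₁`
  have hR1' : ∑ m ∈ M, (11 : ℝ) ^ m.primeFactors.card * |I m| ≤ C₁ * A.size x * L ^ (2 ^ 20 : ℝ) := by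
    have hIle : ∀ m, |I m| ≤ ∑ n ∈ F m, ((n.divisors.card : ℝ)) * A.a (m * n) := by
      intro m
      refine (Finset.abs_sum_le_sum_abs _ _).trans (Finset.sum_le_sum fun n _ => ?_)
      rw [abs_mul, abs_mul, abs_of_nonneg (A.a_nonneg _)]
      have hγ : |(SieveSequence.fiGamma C n : ℝ)| ≤ (n.divisors.card : ℝ) := by
        have := SieveSequence.abs_fiGamma_le C n
        rw [ArithmeticFunction.sigma_zero_apply] at this
        exact_mod_cast this
      have hμ : |(μ (m * n) : ℝ)| ≤ 1 := by exact_mod_cast ArithmeticFunction.abs_moebius_le_one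
      calc |(SieveSequence.fiGamma C n : ℝ)| * |(μ (m * n) : ℝ)| * A.a (m * n)
          ≤ (n.divisors.card : ℝ) * 1 * A.a (m * n) := by gcongr; exact A.a_nonneg _
        _ = (n.divisors.card : ℝ) * A.a (m * n) := by ring
    calc ∑ m ∈ M, (11 : ℝ) ^ m.primeFactors.card * |I m|
        ≤ ∑ m ∈ M, ∑ n ∈ F m, (11 : ℝ) ^ m.primeFactors.card * ((n.divisors.card : ℝ)) * A.a (m * n) := by
          refine Finset.sum_le_sum fun m _ => ?_
          rw [show ∑ n ∈ F m, (11 : ℝ) ^ m.primeFactors.card * ((n.divisors.card : ℝ)) * A.a (m * n) =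
            (11 : ℝ) ^ m.primeFactors.card * ∑ n ∈ F m, ((n.divisors.card : ℝ)) * A.a (m * n) by
            rw [Finset.mul_sum]; refine Finset.sum_congr rfl fun n _ => by ring]
          exact mul_le_mul_of_nonneg_left (hIle m) (by positivity)
      _ ≤ ∑ k ∈ Ioc 0 ⌊x⌋₊, ∑ p ∈ k.divisorsAntidiagonal,
            (11 : ℝ) ^ p.1.primeFactors.card * ((p.2.divisors.card : ℝ)) * A.a (p.1 * p.2) := by
          refine sum_sum_le_sum_divisorsAntidiagonal (f := fun m n =>
            (11 : ℝ) ^ m.primeFactors.card * ((n.divisors.card : ℝ)) * A.a (m * n))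
            (fun m n => mul_nonneg (by positivity) (A.a_nonneg _)) ⌊x⌋₊ M F fun m hm n hn => ?_
          obtain ⟨hm1, -⟩ := Finset.mem_Icc.mp hm
          obtain ⟨hn1, hn2⟩ := Finset.mem_filter.mp hn
          refine ⟨hm1, Nat.succ_le_of_lt (lt_of_le_of_lt (Nat.zero_le _) (Finset.mem_Ioc.mp hn1).1), ?_⟩
          exact Nat.le_floor hn2.1
      _ = ∑ k ∈ Ioc 0 ⌊x⌋₊, A.a k * ∑ p ∈ k.divisorsAntidiagonal,
            (11 : ℝ) ^ p.1.primeFactors.card * ((p.2.divisors.card : ℝ)) := by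
          refine Finset.sum_congr rfl fun k _ => ?_
          rw [Finset.mul_sum]
          refine Finset.sum_congr rfl fun p hp => ?_
          rw [(Nat.mem_divisorsAntidiagonal.mp hp).1]
          ring
      _ ≤ ∑ k ∈ Ioc 0 ⌊x⌋₊, A.a k * ((k.divisors.card : ℝ)) ^ 4 := by
          refine Finset.sum_le_sum fun k _ => ?_
          by_cases hsq : Squarefree k
          · exact mul_le_mul_of_nonneg_left
              (sum_divisorsAntidiagonal_eleven_pow_mul_card_divisors_le hsq) (A.a_nonneg k)
          · rw [hT.a_eq_zero hsq, zero_mul, zero_mul]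
      _ ≤ C₁ * A.size x * L ^ (2 ^ 20 : ℝ) := hT.sum_a_mul_card_divisors_pow_four_le hx8 h16x
  -- Hölder and the numerical tail
  have hH := SieveSequence.sum_six_pow_mul_le_holder M (r := fun m => |I m|)
    (fun m _ => abs_nonneg _)
  refine hH.trans ?_
  exact holder_tail_le_pow hk hA0 hL1 hC₁0 (Finset.sum_nonneg fun m _ => abs_nonneg _)
    (Finset.sum_nonneg fun m _ => mul_nonneg (by positivity) (abs_nonneg _)) hB0 hR1'

end Literature.NumberTheory.Sieve
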